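import Literature.NumberTheory.EllipticCurves.FineSelmerFiniteOfUnramifiedClassesProofs
import Literature.NumberTheory.EllipticCurves.FineSelmerTorsionCoefficientsFiniteProofs
import HarnessLib

/-!
# Statement (A) of Coates–Sujatha at ANY prime in Greenberg's `Sel₀[p]`-form, through a TOTALLY COMPLEX `p`-division field:
# `Sel₀(K_∞, E[p^∞])[p]` finite from the classical `μ = 0` of `K(E[p])` and the archimedean vanishing (the `p = 2` companion
# of `FineSelmerTorsionCoefficientsFiniteProofs` + `FineSelmerFiniteOfUnramifiedClassesProofs`; proved, no named fact, no `sorry`)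

`Proofs` file (theorems only) in topic `NumberTheory/EllipticCurves` (namespaces
`Literature.NumberTheory.EllipticCurves.FineSelmerCoefficientMap` for §A and
`Literature.NumberTheory.EllipticCurves.FineSelmerFiniteOfUnramifiedClasses` for §B, as in the two tree files it extends),
written by the prover seat `cruxlead-stmt-BirchSwinnertonDyer-19573-w2` GEN 3 (cell `bsd-2adic`; `--supports`
stmt-BirchSwinnertonDyer-23921, the B7′ child of crux 202 `OrdKatoHalfAtTwoIso`, whose `μ`-doors
`…OrdKatoHalfAtTwoIsoOptimalMemberMuDoor` / `…IrrMuDoor` consume «`Sel₀(E/ℚ_∞, E[2^∞])[2]` finite»). Closes nothing;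
Conjecture A is not proved unconditionally for any curve here — the named facts `classicalMuVanishes_finite_unramifiedClasses`
(Lang Ch. 5, character form) and `ferreroWashington1979_classicalMuVanishes` stay displayed.

## What is proved

§A. The tree's `finite_fineSelmerInfty_pTorsion_of_finite_torsion` (Lim–Sujatha 2018 §3, proof of Prop. 3.2: the hard half of
«`R(E[p]/K^cyc)` finite ⟺ `Y(E/K^cyc)` finitely generated over `ℤ_p`») assumes `p ≠ 2` at exactly ONE point: at an INFINITE
place `w` the local kernel `ker (H¹(D_w ∩ H, E[p]) → H¹(D_w ∩ H, E[p^∞]))` is killed because `H¹` of a group of order `≤ 2`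
with values in `E[p]` vanishes for ODD `p` (`subgroupH1_geomTorsion_inf_decompInf_eq_zero`). At `p = 2` that group does NOT
vanish in general — it does iff `E(K_w)[2^∞]` is `2`-divisible (one real component at a real `w`): the «narrow versus wide»
phenomenon of the `p = 2` theory (the tree's fine Selmer groups are STRICT at the infinite places).
* `finite_fineSelmerInfty_pTorsion_of_finite_torsion_of_forall_infinitePlace` — ANY prime `p`: if
  `H¹(H ∩ D_w, E[p]) = 0` for every infinite place `w` (`H = Gal(K̄/K_∞)`) and `Sel₀(K_∞, E[p])` is finite, then
  `Sel₀(K_∞, E[p^∞])[p]` is finite. Verbatim the tree's proof, the archimedean step served by the hypothesis;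
  `…_of_odd` re-derives the tree's statement as a check.

§B. The tree's `finite_fineSelmerInfty_of_classicalMuVanishes` (bsd-potss-rkm g33: Coates–Sujatha's Thm. 3.4 reduced to the
character form of Iwasawa's `μ = 0`) hard-codes `p` odd, although the named fact it consumes is stated under
«`Odd p ∨ IsTotallyComplex`» for the field of the `ℤ_p`-extension whose unramified classes are counted — here the
TRIVIALISING field `F = K(M)`. So at `p = 2` the same assembly runs whenever `K(M)` is TOTALLY COMPLEX:
* `finite_fineSelmerInfty_of_classicalMuVanishes_of_odd_or_isTotallyComplex` — §3 of the tree file with `Odd p` replaced by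
  «`Odd p ∨ IsTotallyComplex F`» (verbatim proof).
* `finite_fineSelmerInfty_torsion_of_classicalMuVanishes_divisionField_of_isTotallyComplex` — `M = E[p]`, `F = K(E[p])`:
  `Sel₀(K_∞, E[p])` finite from `ClassicalMuVanishes` of the cyclotomic `ℤ_p`-extension of a totally complex `K(E[p])`.
* `finite_fineSelmerInfty_pTorsion_of_classicalMuVanishes_divisionField_of_isTotallyComplex` — **statement (A) in
  `Sel₀[p]`-form, ANY `p`**: `Sel₀(K_∞, E[p^∞])[p]` finite from the same inputs plus the archimedean vanishing (§A).
* `finite_fineSelmerInfty_pTorsion_of_ferreroWashington_of_isTotallyComplex` — the same with `ClassicalMuVanishes` served by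
  FERRERO–WASHINGTON BY NAME for a `p`-division field ABELIAN over `ℚ`: e.g. `K = ℚ`, `p = 2`, `E[2]` reducible with
  `Δ_E < 0` (`ℚ(E[2]) = ℚ(√Δ_E)` imaginary quadratic; complex conjugation a transposition on `E[2]`, so `H¹ = 0` at `∞`).

References: [LimSujatha2018] §3 (proof of Prop. 3.2); [GreenbergLNM1716] §1 p. 60, §3 (Lemmas 3.1–3.3); [CoatesSujatha2005]
Thm. 3.4 (proof); [Lang1990] Ch. 5 §§1–4; [FerreroWashington1979]; [Washington1997] §13.1; [SerreGaloisCohomology1997] I.§2.4–2.5.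
-/

set_option autoImplicit false

noncomputable section

open scoped Classical Pointwise

universe u

/-! # §A Torsion coefficients at any prime, the archimedean local kernels displayed -/

namespace Literature.NumberTheory.EllipticCurves.FineSelmerCoefficientMap

open NumberField IsDedekindDomain Field Filter Topology
open Literature.NumberTheory.EllipticCurves Literature.NumberTheory.EllipticCurves.GreenbergSelmer
  Literature.NumberTheory.GaloisRepresentations WeierstrassCurve
  Literature.NumberTheory.EllipticCurves.Greenberg1999

section Assembly

variable {K : Type} [Field K] [NumberField K] (W : WeierstrassCurve K) [W.IsElliptic] {p : ℕ}
  [Fact p.Prime] (κ : ZpExtension K p)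

/-- **`Sel₀(K_∞, E[p])` finite ⟹ `Sel₀(K_∞, E[p^∞])[p]` finite, for ANY prime `p`, granted the vanishing of
`H¹(Gal(K̄/K_∞) ∩ D_w, E[p])` at every infinite place `w`** (the cyclotomic `ℤ_p`-extension of a number field `K`, an
elliptic curve `E = W/K`). Verbatim the proof of `finite_fineSelmerInfty_pTorsion_of_finite_torsion` (Lim–Sujatha 2018 §3)
with its single use of `p ≠ 2` — the archimedean local kernels — replaced by the displayed hypothesis `hinf`; at `p = 2`,
`hinf` holds iff complex conjugation at each real `w` acts on `E[2]` with `H¹ = 0` (one real component).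
[cite: LimSujatha2018, §3 (proof of Prop. 3.2)] [cite: GreenbergLNM1716, §3 (Lemmas 3.1–3.3)] -/
theorem finite_fineSelmerInfty_pTorsion_of_finite_torsion_of_forall_infinitePlace (hκ : κ.IsCyclotomic)
    (hinf : ∀ (w : InfinitePlace K)
      (y : subgroupH1 (κ.kerSubgroup ⊓ decompInf w) (W.geomTorsion (p : ℤ))), y = 0)
    (hfin : (fineSelmerInfty (↥(W.geomTorsion (p : ℤ))) κ :
      Set (subgroupH1 κ.kerSubgroup (W.geomTorsion (p : ℤ)))).Finite) :
    Set.Finite {s : W.fineSelmerInfty κ | p • s = 0} := by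
  have hpr : p.Prime := Fact.out
  -- notation
  let H := κ.kerSubgroup
  let Mp : Type := ↥(W.geomTorsion (p : ℤ))
  let ι : subgroupH1 H Mp →+ W.subgroupH1 p H := W.torsionToPrimaryH1Sub p H
  -- the finite set `S` of bad places and places above `p`
  have hSfin : ({v : HeightOneSpectrum (𝓞 K) | (p : 𝓞 K) ∈ v.asIdeal} ∪ W.badPlaces (𝓞 K)).Finite := by
    refine Set.Finite.union ?_ (W.finite_badPlaces_holds (𝓞 K))
    have hne : Ideal.span {(p : 𝓞 K)} ≠ 0 := by
      rw [Ideal.zero_eq_bot, Ne, Ideal.span_singleton_eq_bot]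
      exact_mod_cast hpr.ne_zero
    refine (Ideal.finite_factors hne).subset fun v hv ↦ ?_
    simp only [Set.mem_setOf_eq] at hv ⊢
    exact Ideal.dvd_iff_le.mpr ((Ideal.span_singleton_le_iff_mem _).mpr hv)
  set S := hSfin.toFinset with hSdef
  have hS : ∀ v ∉ S, (p : 𝓞 K) ∉ v.asIdeal ∧ W.HasGoodReductionAt v := by
    intro v hv
    rw [hSdef, Set.Finite.mem_toFinset, Set.mem_union, not_or] at hv
    refine ⟨hv.1, ?_⟩
    by_contra h
    exact hv.2 h
  -- representatives: a uniform `c` and the elements `τ i`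
  have hreps := fun v : HeightOneSpectrum (𝓞 K) ↦
    forall_resOfLe_conjH1_eq_zero_of_reps (M := Mp) hκ v
  choose cv hcv using hreps
  let c : ℕ := S.sup cv
  have hτex : ∀ i : ℕ, ∃ τ : absoluteGaloisGroup K, κ τ = Multiplicative.ofAdd ((i : ℕ) : ℤ_[p]) :=
    fun i ↦ κ.surjective _
  choose τ hτ using hτex
  -- the signature map `Ψ`
  let resv : ∀ v : HeightOneSpectrum (𝓞 K), subgroupH1 H Mp →+ subgroupH1 (H ⊓ decomp v) Mp := fun v ↦
    resOfLe Mp (inf_le_left : H ⊓ decomp v ≤ H)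
  let Ψ : subgroupH1 H Mp →+ ((v : S) → Fin (p ^ c) → subgroupH1 (H ⊓ decomp (v : HeightOneSpectrum (𝓞 K))) Mp) :=
    { toFun := fun x v i ↦ resv v (conjH1 H Mp (τ i) x)
      map_zero' := by ext v i; simp
      map_add' := fun x y ↦ by ext v i; simp }
  -- `R′ = ι⁻¹ Sel₀(K_∞, E[p^∞])`
  let R' : AddSubgroup (subgroupH1 H Mp) := (W.fineSelmerInfty κ).comap ι
  have hR'mem : ∀ x : subgroupH1 H Mp, x ∈ R' ↔ ι x ∈ W.fineSelmerInfty κ := fun x ↦ Iff.rfl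
  -- (a) values of `Ψ` on `R′` lie in the finite local kernels
  have hΨker : ∀ x ∈ R', ∀ (v : S) (i : Fin (p ^ c)),
      Ψ x v i ∈ (W.torsionToPrimaryH1Sub p (H ⊓ decomp (v : HeightOneSpectrum (𝓞 K)))).ker := by
    intro x hx v i
    rw [AddMonoidHom.mem_ker]
    change W.torsionToPrimaryH1Sub p _ (resv v (conjH1 H Mp (τ i) x)) = 0
    rw [← resOfLe_torsionToPrimaryH1Sub, ← WeierstrassCurve.conjH1_torsionToPrimaryH1Sub]
    exact ((mem_fineSelmerInfty_iff_resOfLe κ _).mp ((hR'mem x).mp hx)).1 v (τ i)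
  -- (b) the kernel of `Ψ` on `R′` is contained in `Sel₀(K_∞, E[p])`
  have hΨzero : ∀ x ∈ R', Ψ x = 0 → x ∈ fineSelmerInfty Mp κ := by
    intro x hx hΨ
    have hxS : ι x ∈ W.fineSelmerInfty κ := (hR'mem x).mp hx
    have hxS' := (mem_fineSelmerInfty_iff_resOfLe κ _).mp hxS
    rw [mem_fineSelmerInfty_iff_resOfLe]
    refine ⟨fun v σ ↦ ?_, fun w σ ↦ ?_⟩
    · by_cases hvS : v ∈ S
      · -- representatives
        refine hcv v τ hτ x (fun i hi ↦ ?_) σ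
        have hi' : i < p ^ c := lt_of_lt_of_le hi (Nat.pow_le_pow_right hpr.pos (Finset.le_sup hvS))
        have := congrFun (congrFun hΨ ⟨v, hvS⟩) ⟨i, hi'⟩
        exact this
      · -- good place `v ∤ p`: the local kernel vanishes
        obtain ⟨hpv, hgood⟩ := hS v hvS
        refine eq_zero_of_torsionToPrimaryH1Sub_eq_zero_of_hasGoodReductionAt W κ hκ hpv hgood _ ?_
        rw [← resOfLe_torsionToPrimaryH1Sub, ← WeierstrassCurve.conjH1_torsionToPrimaryH1Sub]
        exact hxS'.1 v σ
    · exact hinf w _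
  -- (c) `R′` is finite
  have hR'fin : (R' : Set (subgroupH1 H Mp)).Finite := by
    -- restrict `Ψ` to `R′`
    let g : R' →+ ((v : S) → Fin (p ^ c) → subgroupH1 (H ⊓ decomp (v : HeightOneSpectrum (𝓞 K))) Mp) :=
      Ψ.comp R'.subtype
    have hgker : ((g.ker : AddSubgroup R') : Set R').Finite := by
      have hsub : ((g.ker : AddSubgroup R') : Set R') ⊆
          (fun r : R' ↦ (r : subgroupH1 H Mp)) ⁻¹' (fineSelmerInfty Mp κ : Set (subgroupH1 H Mp)) := by
        intro r hr
        exact hΨzero r r.2 ((AddMonoidHom.mem_ker).mp hr)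
      exact (hfin.preimage Subtype.val_injective.injOn).subset hsub
    let T : Set ((v : S) → Fin (p ^ c) → subgroupH1 (H ⊓ decomp (v : HeightOneSpectrum (𝓞 K))) Mp) :=
      Set.pi Set.univ fun v ↦ Set.pi Set.univ fun _ ↦
        ((W.torsionToPrimaryH1Sub p (H ⊓ decomp (v : HeightOneSpectrum (𝓞 K)))).ker : Set _)
    have hTfin : T.Finite := by
      refine Set.Finite.pi fun v ↦ Set.Finite.pi fun _ ↦ ?_
      exact W.finite_ker_torsionToPrimaryH1Sub p (H := H ⊓ decomp (v : HeightOneSpectrum (𝓞 K)))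
        W.zsmul_geomPoints_surjective_holds
    have huniv : (g ⁻¹' T) = Set.univ := by
      ext r
      simp only [Set.mem_preimage, Set.mem_univ, iff_true, T, Set.mem_univ_pi]
      intro v i
      exact hΨker r r.2 v i
    have hR'univ : (Set.univ : Set R').Finite := by
      rw [← huniv]
      exact AddMonoidHom.finite_preimage_of_finite_ker g hgker hTfin
    have : (R' : Set (subgroupH1 H Mp)) = (fun r : R' ↦ (r : subgroupH1 H Mp)) '' Set.univ := by
      ext x
      simp only [SetLike.mem_coe, Set.image_univ, Set.mem_range, Subtype.exists, exists_prop,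
        exists_eq_right]
    rw [this]
    exact hR'univ.image _
  -- (d) every `p`-torsion class of `Sel₀(K_∞, E[p^∞])` is `ι x` with `x ∈ R′`
  have hsub : {s : W.fineSelmerInfty κ | p • s = 0} ⊆
      (fun s : W.fineSelmerInfty κ ↦ (s : W.subgroupH1 p H)) ⁻¹' (ι '' (R' : Set (subgroupH1 H Mp))) := by
    intro s hs
    have hs' : p • (s : W.subgroupH1 p H) = 0 := by
      rw [← AddSubgroupClass.coe_nsmul, show p • s = 0 from hs]; rfl
    obtain ⟨x, hx⟩ := W.exists_torsionToPrimaryH1Sub_eq p W.zsmul_geomPoints_surjective_holds hs'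
    refine ⟨x, ?_, hx⟩
    change ι x ∈ W.fineSelmerInfty κ
    rw [show ι x = (s : W.subgroupH1 p H) from hx]
    exact s.2
  exact ((hR'fin.image ι).preimage Subtype.val_injective.injOn).subset hsub


/-- Consistency check: at an ODD prime the displayed archimedean hypothesis is the tree theorem
`subgroupH1_geomTorsion_inf_decompInf_eq_zero`, recovering `finite_fineSelmerInfty_pTorsion_of_finite_torsion`.
[cite: LimSujatha2018, §3 (proof of Prop. 3.2)] [cite: SerreGaloisCohomology1997, I.§2.4 Cor. of Prop. 9] -/
theorem finite_fineSelmerInfty_pTorsion_of_finite_torsion_of_odd (hκ : κ.IsCyclotomic) (hp : Odd p)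
    (hfin : (fineSelmerInfty (↥(W.geomTorsion (p : ℤ))) κ :
      Set (subgroupH1 κ.kerSubgroup (W.geomTorsion (p : ℤ)))).Finite) :
    Set.Finite {s : W.fineSelmerInfty κ | p • s = 0} :=
  finite_fineSelmerInfty_pTorsion_of_finite_torsion_of_forall_infinitePlace W κ hκ
    (fun w y ↦ subgroupH1_geomTorsion_inf_decompInf_eq_zero W hp κ.kerSubgroup w y) hfin

end Assembly

end Literature.NumberTheory.EllipticCurves.FineSelmerCoefficientMap

/-! # §B The class-group road through a totally complex trivialising field -/

namespace Literature.NumberTheory.EllipticCurves.FineSelmerFiniteOfUnramifiedClasses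

open NumberField IsDedekindDomain Field
open Literature.NumberTheory.EllipticCurves Literature.NumberTheory.EllipticCurves.GreenbergSelmer
  Literature.NumberTheory.EllipticCurves.GreenbergVatsal2000
  Literature.NumberTheory.EllipticCurves.FineSelmerTrivialisingRestriction
  Literature.NumberTheory.GaloisRepresentations Literature.NumberTheory.IwasawaTheory

/-! ## §1 `Sel₀(K_∞, M)` finite from the classical `μ = 0` of `K(M)`: `p` odd OR `K(M)` totally complex -/

section Assembly

variable {K : Type} [Field K] [NumberField K] {p : ℕ} [Fact p.Prime]

/-- **`Sel₀(K_∞, M)` is finite when the classical `μ`-invariant of the trivialising field vanishes — `p` odd OR the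
trivialising field totally complex.** Verbatim `finite_fineSelmerInfty_of_classicalMuVanishes` (Coates–Sujatha's argument
modulo the character form of Iwasawa's `μ = 0`, `classicalMuVanishes_finite_unramifiedClasses`), with the scope binder of
that named fact passed through as «`Odd p ∨ IsTotallyComplex F`» instead of `Odd p`.
[cite: CoatesSujatha2005, Thm. 3.4 (proof)] [cite: Lang1990, Ch. 5 §1 Thm. 1.2, §4 Thm. 4.4] -/
theorem finite_fineSelmerInfty_of_classicalMuVanishes_of_odd_or_isTotallyComplex
    (hchar : classicalMuVanishes_finite_unramifiedClasses) (κ : ZpExtension K p)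
    (M : Type) [AddCommGroup M] [DistribMulAction (absoluteGaloisGroup K) M] [TopologicalSpace M]
    [DiscreteTopology M] [Finite M] [ContinuousSMul (absoluteGaloisGroup K) M]
    (hM : ∃ k : ℕ, Nat.card M = p ^ k)
    (F : Type) [Field F] [NumberField F] [Algebra K F] [Algebra.IsAlgebraic K F]
    (hpF : Odd p ∨ NumberField.IsTotallyComplex F)
    (hrange : (absGaloisRestrict K F).range = fixingSubgroupOfModule K M)
    (κF : ZpExtension F p)
    (hker : κF.kerSubgroup = κ.kerSubgroup.comap (absGaloisRestrict K F).toMonoidHom)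
    (hμ : ClassicalMuVanishes κF) :
    (fineSelmerInfty M κ : Set (subgroupH1 κ.kerSubgroup M)).Finite := by
  letI instF : DistribMulAction (absoluteGaloisGroup F) M :=
    DistribMulAction.compHom M (absGaloisRestrict K F).toMonoidHom
  have htriv : ∀ (σ : absoluteGaloisGroup F) (m : M), σ • m = m := fun σ m ↦ by
    have hσ : absGaloisRestrict K F σ ∈ fixingSubgroupOfModule K M := hrange ▸ ⟨σ, rfl⟩
    exact smul_eq_of_mem_fixingSubgroupOfModule hσ m
  have hfinF := hchar F p κF hpF hμ M hM htriv
  have hU := finite_unramifiedHoms_map_of_finite_unramifiedClasses (K := K) htriv κF hfinF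
  rw [map_kerSubgroup_eq_inf κ κF hrange hker] at hU
  exact finite_fineSelmerInfty_of_finite_unramifiedHoms κ hU

end Assembly

/-! ## §2 `M = E[p]`, `F = K(E[p])` totally complex: statement (A) in `Sel₀[p]`-form, any `p` -/

section EllipticCurve

variable {K : Type} [Field K] [NumberField K]

/-- **`Sel₀(K_∞, E[p])` finite from the classical `μ = 0` of a TOTALLY COMPLEX `K(E[p])`, any prime `p`** (for odd `p` the
hypothesis `IsTotallyComplex` is idle: use the tree's `fineSelmerDual_moduleFinite_of_classicalMuVanishes_divisionField`).
Inputs displayed: `classicalMuVanishes_finite_unramifiedClasses` (Lang Ch. 5, character form) and `ClassicalMuVanishes`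
for (every) cyclotomic `ℤ_p`-extension of `K(E[p])`. [cite: CoatesSujatha2005, Thm. 3.4] [cite: Lang1990, Ch. 5 §§1–4] -/
theorem finite_fineSelmerInfty_torsion_of_classicalMuVanishes_divisionField_of_isTotallyComplex
    (hchar : classicalMuVanishes_finite_unramifiedClasses)
    (W : WeierstrassCurve K) [W.IsElliptic] {p : ℕ} [Fact p.Prime]
    (hF : haveI : NeZero p := ⟨(Fact.out : p.Prime).ne_zero⟩
      NumberField.IsTotallyComplex (W.divisionField p))
    (hμ : haveI : NeZero p := ⟨(Fact.out : p.Prime).ne_zero⟩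
      ∀ κF : ZpExtension (W.divisionField p) p, κF.IsCyclotomic → ClassicalMuVanishes κF)
    (κ : ZpExtension K p) (hκ : κ.IsCyclotomic) :
    haveI : NeZero p := ⟨(Fact.out : p.Prime).ne_zero⟩
    (fineSelmerInfty (↥(W.geomTorsion (p : ℤ))) κ :
      Set (subgroupH1 κ.kerSubgroup (W.geomTorsion (p : ℤ)))).Finite := by
  haveI : NeZero p := ⟨(Fact.out : p.Prime).ne_zero⟩
  haveI : NumberField (W.divisionField p) := NumberField.of_module_finite K _
  obtain ⟨κF, hκF⟩ := ZpExtension.exists_isCyclotomic_holds (W.divisionField p) p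
    (GaloisRep.cyclotomicCharacter_range_infinite (W.divisionField p) p)
  haveI : Finite (W.geomTorsion (p : ℤ)) := W.finite_geomTorsion_nat (NeZero.ne p)
  haveI : ContinuousSMul (absoluteGaloisGroup K) (W.geomTorsion (p : ℤ)) :=
    W.continuousSMul_geomTorsion W.isOpen_stabilizer_point_holds p
  have hcard : ∃ k : ℕ, Nat.card (W.geomTorsion (p : ℤ)) = p ^ k :=
    ⟨2, W.natCard_geomTorsion_eq_sq_of_charZero (Fact.out : p.Prime)⟩
  exact finite_fineSelmerInfty_of_classicalMuVanishes_of_odd_or_isTotallyComplex hchar κ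
    (W.geomTorsion (p : ℤ)) hcard (W.divisionField p) (Or.inr hF)
    (range_absGaloisRestrict_divisionField W p) κF
    (kerSubgroup_eq_comap_of_isCyclotomic κ hκ κF hκF) (hμ κF hκF)

/-- **Statement (A) of Coates–Sujatha in Greenberg's `Sel₀[p]`-form — `Sel₀(K_∞, E[p^∞])[p]` finite — for ANY prime `p`,
from: the character form of Iwasawa's `μ = 0` (named fact), `ClassicalMuVanishes` for the cyclotomic `ℤ_p`-extension of a
TOTALLY COMPLEX `K(E[p])`, and the archimedean vanishing `H¹(Gal(K̄/K_∞) ∩ D_w, E[p]) = 0` at every infinite place `w`**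
(`FineSelmerCoefficientMap.finite_fineSelmerInfty_pTorsion_of_finite_torsion_of_forall_infinitePlace`). At `p = 2` over
`K = ℚ` the last two hold for `E[2]` reducible with `Δ_E < 0` (`ℚ(E[2]) = ℚ(√Δ_E)` imaginary quadratic; complex
conjugation a transposition on `E[2]`). [cite: CoatesSujatha2005, Thm. 3.4] [cite: LimSujatha2018, §3 (proof of Prop. 3.2)]
[cite: GreenbergLNM1716, §1 p. 60, §3] -/
theorem finite_fineSelmerInfty_pTorsion_of_classicalMuVanishes_divisionField_of_isTotallyComplex
    (hchar : classicalMuVanishes_finite_unramifiedClasses)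
    (W : WeierstrassCurve K) [W.IsElliptic] {p : ℕ} [Fact p.Prime]
    (hF : haveI : NeZero p := ⟨(Fact.out : p.Prime).ne_zero⟩
      NumberField.IsTotallyComplex (W.divisionField p))
    (hμ : haveI : NeZero p := ⟨(Fact.out : p.Prime).ne_zero⟩
      ∀ κF : ZpExtension (W.divisionField p) p, κF.IsCyclotomic → ClassicalMuVanishes κF)
    (κ : ZpExtension K p) (hκ : κ.IsCyclotomic)
    (hinf : ∀ (w : InfinitePlace K)
      (y : subgroupH1 (κ.kerSubgroup ⊓ decompInf w) (W.geomTorsion (p : ℤ))), y = 0) :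
    Set.Finite {s : W.fineSelmerInfty κ | p • s = 0} :=
  FineSelmerCoefficientMap.finite_fineSelmerInfty_pTorsion_of_finite_torsion_of_forall_infinitePlace W κ hκ hinf
    (finite_fineSelmerInfty_torsion_of_classicalMuVanishes_divisionField_of_isTotallyComplex hchar W hF hμ κ hκ)

/-- **The same with Ferrero–Washington BY NAME**: if the `p`-division field `K(E[p])` is ABELIAN OVER `ℚ` and totally complex,
`IwasawaTheory.ferreroWashington1979_classicalMuVanishes` serves `ClassicalMuVanishes` for its cyclotomic `ℤ_p`-extension, so
`Sel₀(K_∞, E[p^∞])[p]` is finite modulo the two displayed named facts and the archimedean vanishing. (Cell bsd-2adic, `K = ℚ`,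
`p = 2`: `E[2]` reducible with `Δ_E < 0`.) [cite: FerreroWashington1979, main theorem] [cite: CoatesSujatha2005, Thm. 3.4]
[cite: Lang1990, Ch. 5 §§1–4] -/
theorem finite_fineSelmerInfty_pTorsion_of_ferreroWashington_of_isTotallyComplex
    (hchar : classicalMuVanishes_finite_unramifiedClasses) (hFW : ferreroWashington1979_classicalMuVanishes)
    (W : WeierstrassCurve K) [W.IsElliptic] {p : ℕ} [Fact p.Prime]
    (hab : haveI : NeZero p := ⟨(Fact.out : p.Prime).ne_zero⟩
      IsAbelianGalois ℚ (W.divisionField p))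
    (hF : haveI : NeZero p := ⟨(Fact.out : p.Prime).ne_zero⟩
      NumberField.IsTotallyComplex (W.divisionField p))
    (κ : ZpExtension K p) (hκ : κ.IsCyclotomic)
    (hinf : ∀ (w : InfinitePlace K)
      (y : subgroupH1 (κ.kerSubgroup ⊓ decompInf w) (W.geomTorsion (p : ℤ))), y = 0) :
    Set.Finite {s : W.fineSelmerInfty κ | p • s = 0} := by
  haveI : NeZero p := ⟨(Fact.out : p.Prime).ne_zero⟩
  haveI : NumberField (W.divisionField p) := NumberField.of_module_finite K _
  haveI := hab
  exact finite_fineSelmerInfty_pTorsion_of_classicalMuVanishes_divisionField_of_isTotallyComplex hchar W hF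
    (fun κF hκF ↦ hFW (W.divisionField p) p κF hκF) κ hκ hinf

end EllipticCurve

end Literature.NumberTheory.EllipticCurves.FineSelmerFiniteOfUnramifiedClasses

end
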